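import Mathlib
import Summits.KontsevichZagierPeriods.Zeta5Search.Elimination.PencilTransport
import HarnessLib

/-!
# ζ(5) search — class `elim`: THE GAUGE `ρ` AND THE TWO POLYNOMIAL IDENTITIES PER SLOT (E-L18, part 2 of 3;
# cell `pub-zeta5`, fam-elim gen 22/23; continues `Elimination/PencilTransport.lean`)

HONEST FRAMING: systematic search; no irrationality claim unless certified.

OUR work (Summit side; `families/elim/FAMILY.md` §17).  Notation as in E-L17: `D(x) = (U, W, V)(x)`
(`coeffU/W/V`), `C(x) = D(x) ∧ D(x + e₇)` with Plücker coordinates `casUW`, `casUV`, `casVW` (the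
`ζ(3)`-eliminant of the contiguous pair `(x, x+e₇)` and its companion minor), `x⁺ = dsShift x`, `d = dOf`,
`ρ = rhoB = rhoCore · prodFNat`.

1. `dict_values` — under `RegionHyp y j` the three dictionary values are `ρ` times the slot-7 wedges at
   `b = b(y)`: `Q(y) = ρ(y)·(U∧W)(b)` (the `Q`-part of the dictionary, `wedgeDictionary_Q`, PROVED in the D2
   lane), `P̂(y) = ρ(y)·(U∧V)(b)`, `P(y) = ρ(y)·(V∧W)(b)` (definitions `dictPhat`, `dictP` + partner-freeness
   of the wedges, `wedge_slot_free`, `wedge_free`, `coeff_update_sub`).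
2. THE GAUGE (`rhoB_dsShift`, `rhoB_lower`): `ρ(c⁺)·∏_{j∈{1,4,5,6,7}}(c_j + 1) = −d(c)·ρ(c)` and
   `ρ(P − e_i)·(d(P)+1)·χ_i(P) = −P_i · ∏_{(i,m)∈E}(P₀ + 1 − P_i − P_m) · ρ(P)` (`E` = the fifteen edge pairs of
   `ρ`, `χ_i` = `chiOf`), pure factorial bookkeeping over `rhoB = rhoCore · prodFNat` (`rhoB_eq_core`).
3. `pencil_coeff_identities` — the two polynomial identities of the slot-`s+1` bridge (`x = c − e_{s+1}`,
   `P = c⁺`): `fanCoeff P (s+1) · edgeProd P (s+1) = χ_{s+1}(P) · Π₇((s 6)•x)` and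
   `pencilBase c · ∏_{j∈{1,4,5,6,7}}(c_j+1) = −P_{s+1} · ∏_{k≤6}(((s 6)•x)_k + 1)`, closed by evaluation.
Part 3 (`Elimination/PencilBridge.lean`) assembles these with part 1 into `dictPencil_at` / `dictStar_at`.
What this is NOT: anything about sizes, denominators, valuations or irrationality; the class verdict is
unchanged (T1 NO / T2 NO / T4 YES).
-/

noncomputable section

open Finset

namespace Summit.KontsevichZagierPeriods.Zeta5Search.Elimination

open Summit.KontsevichZagierPeriods.Zeta5Search.DualSeries (InBox numPoly)
open Summit.KontsevichZagierPeriods.Zeta5Search.WedgeDictionary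
open Summit.KontsevichZagierPeriods.Zeta5Search.SymmetricGauge
open Summit.KontsevichZagierPeriods.Zeta5Search.CasoratianValuation (shift)
open Literature.NumberTheory.Irrationality.BrownZudilin2022 (bOfA Converges QOf convergenceForms)

/-! ### 3. The dictionary values are `ρ` times the slot-7 wedges -/

/-- Under `RegionHyp y j`: `Q(y) = ρ(y)·(U∧W)(b)`, `P̂(y) = ρ(y)·(U∧V)(b)`, `P(y) = ρ(y)·(V∧W)(b)` at
`b = b(y)` — the `Q`-part of the dictionary (`wedgeDictionary_Q`, PROVED) and the partner-freeness of the
three wedges. -/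
theorem dict_values {y : Fin 8 → ℤ} {j : ℕ} (h : RegionHyp y j) :
    (QOf y : ℚ) = rhoOf y * casUW (bOfA y) ∧ dictPhat y j = rhoOf y * casUV (bOfA y) ∧
      dictP y j = rhoOf y * casVW (bOfA y) := by
  obtain ⟨hj, hconv, hreg, hd, hpart⟩ := h
  have hj' := mem_Icc.1 hj
  have hjr := hreg j hj
  have h7r := hreg 7 (by simp)
  have hb : InBox (bOfA y) := by
    refine ⟨by omega, fun k hk => ?_⟩
    have := hreg (k + 1) (mem_Icc.2 ⟨by omega, by have := mem_range.1 hk; omega⟩)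
    omega
  have hjN : bOfA y j ≤ bOfA y 0 := by omega
  have h7N : bOfA y 7 ≤ bOfA y 0 := by omega
  obtain ⟨fUW, fUV⟩ := wedge_slot_free (bOfA y) hb hd hj hjN h7N
  have hi : j - 1 ∈ range 7 := mem_range.2 (by omega)
  have hjj : j - 1 + 1 = j := by omega
  have S := coeff_update_sub (bOfA y) hb hd hi (k := 6) (by simp) (by rw [hjj]; exact hjN) (by simpa using h7N)
  rw [hjj] at S
  obtain ⟨-, SW, SV⟩ := S
  have fVW : coeffV (bOfA y) * coeffW (Function.update (bOfA y) j (bOfA y j + 1)) -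
      coeffV (Function.update (bOfA y) j (bOfA y j + 1)) * coeffW (bOfA y) = casVW (bOfA y) :=
    wedge_free coeffV coeffW (bOfA y) j (6 + 1) _ SV SW
  refine ⟨?_, ?_, ?_⟩
  · rw [wedgeDictionary_Q y j hj hconv hreg hd hpart, fUW]
  · unfold dictPhat; rw [fUV]
  · unfold dictP; rw [← fVW]; ring

/-! ### 4. The gauge `ρ`: the diagonal step and one slot step -/

/-- `prodFNat` as a rational number, expanded. -/
theorem prodFNat_cast (b : ℕ → ℤ) :
    (prodFNat b : ℚ) = (Epairs.map fun jk => (((b 0 - b jk.1 - b jk.2).toNat.factorial : ℕ) : ℚ)).prod *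
      ((((b 2).toNat.factorial : ℕ) : ℚ) * (((b 3).toNat.factorial : ℕ) : ℚ)) := by
  simp only [prodFNat, Epairs, List.map_cons, List.map_nil, List.prod_cons, List.prod_nil]
  push_cast
  ring

/-- `prodFNat(c⁺) = (c₂+1)(c₃+1)·prodFNat(c)` (the edge forms are invariant under the diagonal step). -/
theorem prodFNat_dsShift (c : ℕ → ℤ) (h2 : 0 ≤ c 2) (h3 : 0 ≤ c 3) :
    (prodFNat (dsShift c) : ℚ) = ((c 2 : ℚ) + 1) * ((c 3 : ℚ) + 1) * (prodFNat c : ℚ) := by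
  have hE : (Epairs.map fun jk => (((dsShift c 0 - dsShift c jk.1 - dsShift c jk.2).toNat.factorial : ℕ) : ℚ)) =
      (Epairs.map fun jk => (((c 0 - c jk.1 - c jk.2).toNat.factorial : ℕ) : ℚ)) :=
    List.map_congr_left fun jk hjk => by
      obtain ⟨h1, -, h2', -, -⟩ := epairs_bounds jk hjk
      rw [dsShift_zero, dsShift_of_pos c h1, dsShift_of_pos c h2',
        show c 0 + 2 - (c jk.1 + 1) - (c jk.2 + 1) = c 0 - c jk.1 - c jk.2 by ring]
  rw [prodFNat_cast, prodFNat_cast, hE, show dsShift c 2 = c 2 + 1 from dsShift_succ c 1,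
    show dsShift c 3 = c 3 + 1 from dsShift_succ c 2, toNat_factorial_succ _ h2, toNat_factorial_succ _ h3]
  ring

/-- `ρ_core(c⁺)·∏_{j=1}^{7}(c_j+1) = −d(c)·ρ_core(c)`. -/
theorem rhoCore_dsShift (c : ℕ → ℤ) (hc : InBox c) (hd : 1 ≤ dOf c) :
    rhoCore (dsShift c) * ∏ j ∈ range 7, ((c (j + 1) : ℚ) + 1) = -((dOf c : ℚ) * rhoCore c) := by
  have hsum : 0 ≤ ∑ j ∈ range 7, c (j + 1) := sum_nonneg fun j hj => (hc.2 j hj).1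
  have hsg : (-1 : ℚ) ^ (∑ j ∈ range 7, dsShift c (j + 1)).toNat =
      -(-1 : ℚ) ^ (∑ j ∈ range 7, c (j + 1)).toNat := by
    rw [sum_dsShift, show (∑ j ∈ range 7, c (j + 1) + 7).toNat = (∑ j ∈ range 7, c (j + 1)).toNat + 7 by omega,
      pow_add]
    norm_num
  have hD : (((dOf c).toNat.factorial : ℕ) : ℚ) = (dOf c : ℚ) * (((dOf c - 1).toNat.factorial : ℕ) : ℚ) := by
    have e := toNat_factorial_succ (dOf c - 1) (by omega)
    rw [sub_add_cancel] at e
    rw [e]; push_cast; ring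
  have hF : (∏ j ∈ range 7, (((c (j + 1)).toNat.factorial : ℕ) : ℚ)) ≠ 0 :=
    prod_ne_zero_iff.2 fun j _ => by positivity
  have hB : (∏ j ∈ range 7, ((c (j + 1) : ℚ) + 1)) ≠ 0 :=
    prod_ne_zero_iff.2 fun j hj => by
      have : (0 : ℚ) ≤ c (j + 1) := by exact_mod_cast (hc.2 j hj).1
      exact ne_of_gt (by linarith)
  have hD' : (((dOf c - 1).toNat.factorial : ℕ) : ℚ) ≠ 0 := by positivity
  have hd0 : (dOf c : ℚ) ≠ 0 := by
    have : (1 : ℚ) ≤ dOf c := by exact_mod_cast hd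
    exact ne_of_gt (by linarith)
  unfold rhoCore
  rw [hsg, slotFactorials_dsShift c hc, dOf_dsShift, hD]
  field_simp

/-- **(ρ1) the gauge along the diagonal**: `ρ(c⁺) · ∏_{j∈{1,4,5,6,7}}(c_j + 1) = −d(c) · ρ(c)`. -/
theorem rhoB_dsShift (c : ℕ → ℤ) (hc : InBox c) (hd : 1 ≤ dOf c) :
    rhoB (dsShift c) * ((([1, 4, 5, 6, 7] : List ℕ).map fun j => ((c j : ℚ) + 1)).prod) =
      -((dOf c : ℚ) * rhoB c) := by
  have h := rhoCore_dsShift c hc hd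
  rw [rhoB_eq_core, rhoB_eq_core, prodFNat_dsShift c (hc.2 1 (by simp)).1 (hc.2 2 (by simp)).1]
  simp only [prod_range_succ, prod_range_zero, one_mul, List.map_cons, List.map_nil, List.prod_cons,
    List.prod_nil, mul_one] at h ⊢
  linear_combination (prodFNat c : ℚ) * h

/-- The product over the edge pairs through slot `i` of `P₀ + 1 − P_i − P_m`. -/
def edgeProd (P : ℕ → ℤ) (i : ℕ) : ℚ :=
  (Epairs.map fun jk => if jk.1 = i ∨ jk.2 = i then ((P 0 : ℚ) + 1 - P jk.1 - P jk.2) else 1).prod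

/-- `ρ_core(P − e_{s+1})·(d(P)+1) = −P_{s+1}·ρ_core(P)`. -/
theorem rhoCore_lower (P : ℕ → ℤ) {s : ℕ} (hs : s < 7) (hP : InBox P) (hi : 1 ≤ P (s + 1))
    (hd : 0 ≤ dOf P) :
    rhoCore (Function.update P (s + 1) (P (s + 1) - 1)) * ((dOf P : ℚ) + 1) = -((P (s + 1) : ℚ) * rhoCore P) := by
  set y := Function.update P (s + 1) (P (s + 1) - 1) with hy
  have y0 : y 0 = P 0 := Function.update_of_ne (by omega) _ _
  have ys : y (s + 1) = P (s + 1) - 1 := Function.update_self _ _ _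
  have yk : ∀ k, k ≠ s + 1 → y k = P k := fun k hk => Function.update_of_ne hk _ _
  have hsum : ∑ j ∈ range 7, y (j + 1) = ∑ j ∈ range 7, P (j + 1) - 1 := by
    have e : ∀ j ∈ range 7, y (j + 1) = P (j + 1) + (if j = s then -1 else 0) := fun j hj => by
      split_ifs with h
      · rw [h, ys]; ring
      · rw [yk _ (by omega)]; ring
    rw [sum_congr rfl e, sum_add_distrib, sum_ite_eq' (range 7) s (fun _ => (-1 : ℤ)), if_pos (mem_range.2 hs)]
    ring
  have hdy : dOf y = dOf P + 1 := by unfold dOf; rw [y0, hsum]; ring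
  have hprod : ∏ j ∈ range 7, (((P (j + 1)).toNat.factorial : ℕ) : ℚ) =
      (P (s + 1) : ℚ) * ∏ j ∈ range 7, (((y (j + 1)).toNat.factorial : ℕ) : ℚ) := by
    have e : ∀ j ∈ range 7, (((P (j + 1)).toNat.factorial : ℕ) : ℚ) =
        (if j = s then (P (s + 1) : ℚ) else 1) * (((y (j + 1)).toNat.factorial : ℕ) : ℚ) := fun j hj => by
      split_ifs with h
      · rw [h, ys]
        have e := toNat_factorial_succ (P (s + 1) - 1) (by omega)
        rw [sub_add_cancel] at e
        rw [e]; push_cast; ring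
      · rw [yk _ (by omega), one_mul]
    rw [prod_congr rfl e, prod_mul_distrib, prod_ite_eq' (range 7) s (fun _ => (P (s + 1) : ℚ)),
      if_pos (mem_range.2 hs)]
  have hsumP : P (s + 1) ≤ ∑ j ∈ range 7, P (j + 1) :=
    single_le_sum (f := fun j => P (j + 1)) (fun j hj => (hP.2 j hj).1) (mem_range.2 hs)
  have hsg : (-1 : ℚ) ^ (∑ j ∈ range 7, P (j + 1)).toNat =
      -(-1 : ℚ) ^ (∑ j ∈ range 7, y (j + 1)).toNat := by
    rw [hsum, show (∑ j ∈ range 7, P (j + 1)).toNat = (∑ j ∈ range 7, P (j + 1) - 1).toNat + 1 by omega,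
      pow_succ]
    ring
  have hDy : (((dOf y).toNat.factorial : ℕ) : ℚ) =
      ((dOf P : ℚ) + 1) * (((dOf P).toNat.factorial : ℕ) : ℚ) := by
    rw [hdy]; exact toNat_factorial_succ _ hd
  have hFy : (∏ j ∈ range 7, (((y (j + 1)).toNat.factorial : ℕ) : ℚ)) ≠ 0 :=
    prod_ne_zero_iff.2 fun j _ => by positivity
  have hDP : (((dOf P).toNat.factorial : ℕ) : ℚ) ≠ 0 := by positivity
  have hd1 : (dOf P : ℚ) + 1 ≠ 0 := by
    have : (0 : ℚ) ≤ dOf P := by exact_mod_cast hd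
    exact ne_of_gt (by linarith)
  have hPs : (P (s + 1) : ℚ) ≠ 0 := by
    have : (1 : ℚ) ≤ P (s + 1) := by exact_mod_cast hi
    exact ne_of_gt (by linarith)
  unfold rhoCore
  rw [hprod, hsg, hDy]
  field_simp

/-- `prodFNat(P − e_{s+1})·χ_{s+1}(P) = ∏_{(s+1,m)∈E}(P₀ + 1 − P_{s+1} − P_m) · prodFNat(P)`. -/
theorem prodFNat_lower (P : ℕ → ℤ) {s : ℕ} (hs : s < 7) (hi : 1 ≤ P (s + 1))
    (hE : ∀ jk ∈ Epairs, P jk.1 + P jk.2 ≤ P 0) :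
    (prodFNat (Function.update P (s + 1) (P (s + 1) - 1)) : ℚ) * (chiOf P (s + 1) : ℚ) =
      edgeProd P (s + 1) * (prodFNat P : ℚ) := by
  set y := Function.update P (s + 1) (P (s + 1) - 1) with hy
  have y0 : y 0 = P 0 := Function.update_of_ne (by omega) _ _
  have ys : y (s + 1) = P (s + 1) - 1 := Function.update_self _ _ _
  have yk : ∀ k, k ≠ s + 1 → y k = P k := fun k hk => Function.update_of_ne hk _ _
  have hpair : (Epairs.map fun jk => (((y 0 - y jk.1 - y jk.2).toNat.factorial : ℕ) : ℚ)).prod =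
      edgeProd P (s + 1) *
        (Epairs.map fun jk => (((P 0 - P jk.1 - P jk.2).toNat.factorial : ℕ) : ℚ)).prod := by
    unfold edgeProd
    rw [← List.prod_map_mul]
    congr 1
    refine List.map_congr_left fun jk hjk => ?_
    obtain ⟨h1, h17, h2, h27, h12⟩ := epairs_bounds jk hjk
    have hX : 0 ≤ P 0 - P jk.1 - P jk.2 := by have := hE jk hjk; omega
    rw [y0]
    by_cases ha : jk.1 = s + 1
    · have hb : jk.2 ≠ s + 1 := by omega
      have hX' : 0 ≤ P 0 - P (s + 1) - P jk.2 := by rw [← ha]; exact hX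
      rw [if_pos (Or.inl ha), yk _ hb, ha, ys,
        show P 0 - (P (s + 1) - 1) - P jk.2 = (P 0 - P (s + 1) - P jk.2) + 1 by ring,
        toNat_factorial_succ _ hX']
      push_cast; ring
    · by_cases hb : jk.2 = s + 1
      · have hX' : 0 ≤ P 0 - P jk.1 - P (s + 1) := by rw [← hb]; exact hX
        rw [if_pos (Or.inr hb), yk _ ha, hb, ys,
          show P 0 - P jk.1 - (P (s + 1) - 1) = (P 0 - P jk.1 - P (s + 1)) + 1 by ring,
          toNat_factorial_succ _ hX']
        push_cast; ring
      · rw [if_neg (by tauto), yk _ ha, yk _ hb, one_mul]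
  have hslot : ((((P 2).toNat.factorial : ℕ) : ℚ) * (((P 3).toNat.factorial : ℕ) : ℚ)) =
      (chiOf P (s + 1) : ℚ) * ((((y 2).toNat.factorial : ℕ) : ℚ) * (((y 3).toNat.factorial : ℕ) : ℚ)) := by
    unfold chiOf
    by_cases h2 : s + 1 = 2
    · rw [if_pos (Or.inl h2), ← h2, ys, yk 3 (by omega)]
      have e := toNat_factorial_succ (P (s + 1) - 1) (by omega)
      rw [sub_add_cancel] at e
      rw [e]; push_cast; ring
    · by_cases h3 : s + 1 = 3
      · rw [if_pos (Or.inr h3), ← h3, ys, yk 2 (by omega)]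
        have e := toNat_factorial_succ (P (s + 1) - 1) (by omega)
        rw [sub_add_cancel] at e
        rw [e]; push_cast; ring
      · rw [if_neg (by tauto), yk 2 (Ne.symm h2), yk 3 (Ne.symm h3)]; push_cast; ring
  rw [prodFNat_cast, prodFNat_cast, hpair, hslot]
  ring

/-- **(ρ2) the gauge of one slot step**:
`ρ(P − e_{s+1})·(d(P)+1)·χ_{s+1}(P) = −P_{s+1}·∏_{(s+1,m)∈E}(P₀+1−P_{s+1}−P_m)·ρ(P)`. -/
theorem rhoB_lower (P : ℕ → ℤ) {s : ℕ} (hs : s < 7) (hP : InBox P) (hi : 1 ≤ P (s + 1)) (hd : 0 ≤ dOf P)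
    (hE : ∀ jk ∈ Epairs, P jk.1 + P jk.2 ≤ P 0) :
    rhoB (Function.update P (s + 1) (P (s + 1) - 1)) * ((dOf P : ℚ) + 1) * (chiOf P (s + 1) : ℚ) =
      -((P (s + 1) : ℚ) * edgeProd P (s + 1) * rhoB P) := by
  have h1 := rhoCore_lower P hs hP hi hd
  have h2 := prodFNat_lower P hs hi hE
  rw [rhoB_eq_core, rhoB_eq_core]
  linear_combination ((prodFNat (Function.update P (s + 1) (P (s + 1) - 1)) : ℚ) * (chiOf P (s + 1) : ℚ)) * h1 -
    ((P (s + 1) : ℚ) * rhoCore P) * h2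

/-! ### 5. The two polynomial identities per slot -/

/-- The values of `(s+1 7) • x`. -/
theorem permLower_swap6_apply (s : Fin 7) (x : ℕ → ℤ) (k : ℕ) :
    permLower (Equiv.swap s 6) x k =
      if k = 7 then x (s.val + 1) else if k = s.val + 1 then x 7 else x k := by
  by_cases hk : 1 ≤ k ∧ k ≤ 7
  · obtain ⟨m, rfl⟩ : ∃ m : Fin 7, k = m.val + 1 := ⟨⟨k - 1, by omega⟩, by simp only; omega⟩
    rw [permLower_apply_succ]
    have key : ((Equiv.swap s 6 m).val + 1 : ℕ) =
        if m.val + 1 = 7 then s.val + 1 else if m.val + 1 = s.val + 1 then 7 else m.val + 1 := by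
      fin_cases s <;> fin_cases m <;> decide
    rw [key]
    split_ifs <;> rfl
  · rw [permLower_apply_of_not _ _ hk, if_neg (by omega), if_neg (by have := s.isLt; omega)]

/-- The definition of the diagonal translate, pointwise. -/
theorem dsShift_apply (c : ℕ → ℤ) (k : ℕ) : dsShift c k = if k = 0 then c 0 + 2 else c k + 1 := rfl

/-- **The two polynomial identities of the slot-`s+1` bridge** (`x = c − e_{s+1}`, `P = c⁺`):
`fanCoeff P (s+1) · edgeProd P (s+1) = χ_{s+1}(P) · Π₇((s 6)•x)` and
`pencilBase c · ∏_{j∈{1,4,5,6,7}}(c_j+1) = −P_{s+1} · ∏_{k≤6}(((s 6)•x)_k + 1)`. -/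
theorem pencil_coeff_identities (c : ℕ → ℤ) (s : ℕ) (hs : s < 7) :
    ((fanCoeff (dsShift c) (s + 1) : ℚ) * edgeProd (dsShift c) (s + 1) =
        (chiOf (dsShift c) (s + 1) : ℚ) *
          pencilPi (permLower (Equiv.swap (⟨s, hs⟩ : Fin 7) 6) (Function.update c (s + 1) (c (s + 1) - 1)))) ∧
      ((pencilBase c : ℚ) * ((([1, 4, 5, 6, 7] : List ℕ).map fun j => ((c j : ℚ) + 1)).prod) =
        -((dsShift c (s + 1) : ℚ) *
          ∏ k ∈ range 6, ((permLower (Equiv.swap (⟨s, hs⟩ : Fin 7) 6)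
            (Function.update c (s + 1) (c (s + 1) - 1)) (k + 1) : ℚ) + 1))) := by
  interval_cases s <;> refine ⟨?_, ?_⟩ <;>
  · simp only [fanCoeff, chiOf, nonEdgePartners, edgeProd, Epairs, pencilPi, pencilBase, List.map_cons, List.map_nil,
      List.prod_cons, List.prod_nil, prod_range_succ, prod_range_zero, one_mul, mul_one]
    simp only [permLower_swap6_apply, dsShift_apply, Function.update_apply]
    norm_num
    ring

end Summit.KontsevichZagierPeriods.Zeta5Search.Elimination

end
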